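import Summits.ResolutionOfSingularities.ResolutionOfSingularities.Theorems.FrobeniusLadderFInjectiveMacaulayficationFCUnguardedAprimePow
import Summits.ResolutionOfSingularities.ResolutionOfSingularities.Theorems.FrobeniusLadderFInjectiveMacaulayficationSpreadLocFix
import Summits.ResolutionOfSingularities.ResolutionOfSingularities.Theorems.FrobeniusLadderFInjectiveMacaulayficationRegularPointClause
import Mathlib.RingTheory.KrullDimension.Zero
import HarnessLib

/-!
# FC″(dim ≥ 4) at a bad point of local dimension ≤ 3 by ONE mechanism: the (A′) datum in LocFix currency survives powers
# (`locFixData_pow`) and the pow-assembly `fcUnguardedLocDimLe3_of_aprime_pow` (crux `FInjectiveMacaulayfication`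
# stmt-ResolutionOfSingularities-15315, chain w45a; res-L1-w45a-plan-1 R16.19 (3) / R16.21 (2) / R16.23 (1), currency call LF 20:45:42Z)

[OURS · L1 W4.5a · res-L1-w45a-stub-3] Support file (`--supports stmt-ResolutionOfSingularities-15315 --as helper`) for the crux
`FrobeniusLadder.FInjectiveMacaulayfication`; NOT a statement of any manuscript; replaces the role of NOTHING in H. Hironaka's manuscript;
AI-written, weaker than expert review. Three `Prop`-valued CANDIDATE statements are declared (OURS, not facts; no instance, no notation),
all by ONE-TOKEN edits of the texts of record in `…FCUnguardedAprime` (p566975):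
* `LocFixAtNonClosedDimOne` (T1‴) = `FCUnguardedAprime.LocFixAtNonClosed` with the guards `2 ≤ dim 𝒪_η → dim 𝒪_η ≤ 3 →` replaced by
  `ringKrullDim 𝒪_η = 1 →` — the dimension-one LocFix rung, to be PROVED by res-L1-w45a-stub-1 (local conductor route, plan-1 R16.20 (1));
* `SpreadGoodAprimeLF` (T2′-LF) = `FCUnguardedAprime.SpreadGoodAprime` with `LocFixDataFull ↦ LocFixData` (res-L1-w45a-stub-2 AGREE
  20:36:47Z) — a THEOREM modulo Datta–Murayama Thm. B + openness of the CM locus by stub-2's `SpreadLocFix` (p567448):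
  `spreadGoodAprimeLF_of_named`;
* `FCUnguardedLocDimLe3` = `FCUnguardedRungs.FCUnguardedDimGe4` verbatim with `ringKrullDim 𝒪_η ≤ 3 →` inserted before the conclusion
  (where `FCUnguardedAprime.FCUnguardedLowDim` has `2 ≤ · → · ≤ 3 →`).

PROVED here (no named fact asserted):
* §1 `locFixData_pow` — the (A′) datum in LocFix currency (charts FULL at the primes OVER `𝔪_η` only) survives powers: the degree-`(k+1)`
  monomial chart `𝒪_η[(c′)ᵏ⁺¹/(c′_{w₀} b)]` is the localisation of `𝒪_η[(c′)/c′_{w₀}]` away from `b/c′_{w₀}ᵏ`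
  (`FCUnguardedAprimePow.isLocalization_away_mul_chart`, p568778) and the structure maps from `𝒪_η` are compatible
  (`blowupAlgebraMul_comp_algebraMap`), so a prime over `𝔪_η` contracts to a prime over `𝔪_η`;
* §2 `spreadGoodAprimeLF_of_named (hDM) (hCMo) : SpreadGoodAprimeLF` (stub-2's kernel BY NAME);
* §3 **`fcUnguardedLocDimLe3_of_aprime_pow : LocFixAtNonClosedDimOne → LocFixAtNonClosed → SpreadGoodAprimeLF → RelClosedSubsetFixPow →
  FCUnguardedLocDimLe3`** — the pow-assembly of `FCUnguardedAprimePow.fcUnguardedLowDim_of_aprime_pow` in LF currency with the guard widened by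
  the case split `dim 𝒪_η ≤ 0 ∨ = 1 ∨ 2…3` (`dim ≤ 0` is vacuous: a zero-dimensional stalk of the integral `X₁` is a field, hence regular,
  hence F-good — `RegularPointClause.fiClause_stalk_of_isRegularLocalRing` — contradicting the bad-point hypothesis);
* §4 the splitter `fcUnguardedDimGe4_of_le3_ge4 : FCUnguardedLocDimLe3 → FCUnguardedLocDimGe4 → FCUnguardedDimGe4` and the corollary
  **`fcUnguardedLocDimLe3_of_facts (hL hG h081R hP hDM hCMo) : LocFixAtNonClosedDimOne → RelClosedSubsetFixPow → FCUnguardedLocDimLe3`**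
  ((T1′) := `FCUnguardedAprime.locFixAtNonClosed_of_facts` p564701/p566975, (T2′-LF) := §2) — the term res-L1-w45a-lead-1's door v31 consumes.

References: The Stacks Project, Tags 080A / 0804 (charts of blowing up a power), folklore bookkeeping otherwise.
-/

-- single-problem summit: the doubled namespace component is forced
set_option linter.dupNamespace false

noncomputable section

open AlgebraicGeometry CategoryTheory Literature.AlgebraicGeometry.Resolution TopologicalSpace IsLocalRing
open Pointwise

namespace Summit.ResolutionOfSingularities.ResolutionOfSingularities.Theorems.FInjectiveMacaulayfication.FCUnguardedLocDimLe3

open Summit.ResolutionOfSingularities.ResolutionOfSingularities.Theorems.FInjectiveMacaulayfication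
open Summit.ResolutionOfSingularities.ResolutionOfSingularities.Theorems.FInjectiveMacaulayfication.SliceableCentre (CMCl FCl FullCl)

/-! ## §0 The statements -/

/-- [OURS · CANDIDATE statement, not a fact] **(T1‴) the (A′) LocFix datum at a non-closed bad point of LOCAL DIMENSION ONE** —
`FCUnguardedAprime.LocFixAtNonClosed` (p566975) with the guards `2 ≤ ringKrullDim 𝒪_η → ringKrullDim 𝒪_η ≤ 3 →` replaced by the single
binder `ringKrullDim 𝒪_η = 1 →` (same coercion path: the numeral elaborated in `WithBot ℕ∞`). Expected proof (res-L1-w45a-plan-1 R16.20 (1),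
res-L1-w45a-tri-2 20:33:28Z (c); res-L1-w45a-stub-1's object): `A = 𝒪_{X₁,η}` is a one-dimensional local domain essentially of finite type
over `k`, not normal (normal of dimension one ⇒ regular ⇒ F-good); its normalisation `Ā` is module-finite and a semilocal PID, the conductor
`𝔠 = t Ā` is a nonzero proper `Ā`-ideal of `A`, and for generators `c′` of `𝔠` the charts `A[𝔠/c′_j] = Ā[1/ā_j]` are localisations of `Ā`,
whose local rings over `𝔪` are DVRs, hence FULL. [candidate statement, OURS; expected] -/
@[conjecture] def LocFixAtNonClosedDimOne : Prop :=
  ∀ (p : ℕ), p.Prime → ∀ (k : Type) [Field k] [CharP k p]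
    (X₁ : Scheme.{0}) (f₁ : X₁ ⟶ Spec (.of k)),
      IsSeparated f₁ → LocallyOfFiniteType f₁ → QuasiCompact f₁ → IsIntegral X₁ → 4 ≤ topologicalKrullDim X₁ →
      (∀ x : X₁, CMCl (X₁.presheaf.stalk x)) →
      ∀ η : X₁, ¬ IsClosed ({η} : Set X₁) → ¬ FCl p (X₁.presheaf.stalk η) →
        ringKrullDim (X₁.presheaf.stalk η) = 1 →
        (∀ y : X₁, y ⤳ η → y ≠ η → FCl p (X₁.presheaf.stalk y)) →
        ∃ (n' : ℕ) (c' : Fin n' → X₁.presheaf.stalk η), FCUnguardedAprime.LocFixData p X₁ η n' c'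


/-- [OURS · CANDIDATE statement, not a fact — THEOREM modulo named facts, `spreadGoodAprimeLF_of_named`] **(T2′-LF) spread of an (A′)
datum in LocFix currency** — `FCUnguardedAprime.SpreadGoodAprime` (p566975) with the single token change `LocFixDataFull ↦ LocFixData`
(res-L1-w45a-stub-2 AGREE 20:36:47Z): fullness over the proper generizations of `η` is not assumed, it FOLLOWS (stub-2's structural finding,
p567448: the non-FULL locus of one blow-up is closed, its proper image misses `η` by Stacks 0804, uniqueness of blow-ups). [candidate
statement, OURS; theorem modulo DattaMurayama2024 Thm. B + CMLocusOpen] -/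
@[conjecture] def SpreadGoodAprimeLF : Prop :=
  ∀ (p : ℕ), p.Prime → ∀ (k : Type) [Field k] [CharP k p]
    (X₁ : Scheme.{0}) (f₁ : X₁ ⟶ Spec (.of k)),
      IsSeparated f₁ → LocallyOfFiniteType f₁ → QuasiCompact f₁ → IsIntegral X₁ → 4 ≤ topologicalKrullDim X₁ →
      (∀ x : X₁, CMCl (X₁.presheaf.stalk x)) →
      ∀ (η : X₁) (n' : ℕ) (c' : Fin n' → X₁.presheaf.stalk η), FCUnguardedAprime.LocFixData p X₁ η n' c' →
        ∃ (J : X₁.IdealSheafData) (U : X₁.Opens), J ≠ ⊥ ∧ η ∈ (J.support : Set X₁) ∧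
          stalkIdeal J η = Ideal.span (Set.range c') ∧ η ∈ (U : Set X₁) ∧
          FCUnguardedAprime.GoodOver p X₁ J ((J.support : Set X₁) ∩ (U : Set X₁))


/-- [OURS · CANDIDATE statement, not a fact] **FC″(dim ≥ 4) at a non-closed bad point of LOCAL DIMENSION ≤ 3** —
`FCUnguardedRungs.FCUnguardedDimGe4` VERBATIM with `ringKrullDim 𝒪_η ≤ 3 →` inserted before the conclusion (where
`FCUnguardedAprime.FCUnguardedLowDim` has `2 ≤ · → · ≤ 3 →`): by res-L1-w45a-plan-1 R16.19 (2) the (A′) route is ONE mechanism for all local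
dimensions ≤ 3 — (T1‴)/(T1′) datum, (T2′-LF) spread, (T3′-pow) relative fix — PROVED below (`fcUnguardedLocDimLe3_of_aprime_pow`); local
dimension ≥ 4 (schemes of dimension ≥ 5) is the declared residual `FCUnguardedAprime.FCUnguardedLocDimGe4`. [candidate statement, OURS] -/
@[conjecture] def FCUnguardedLocDimLe3 : Prop :=
  ∀ (p : ℕ), p.Prime → ∀ (k : Type) [Field k] [CharP k p]
    (X₁ : Scheme.{0}) (f₁ : X₁ ⟶ Spec (.of k)),
      IsSeparated f₁ → LocallyOfFiniteType f₁ → QuasiCompact f₁ → IsIntegral X₁ → 4 ≤ topologicalKrullDim X₁ →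
      (∀ x : X₁, (∀ d : ℕ, ringKrullDim (X₁.presheaf.stalk x) = d → ∀ s : Fin d → X₁.presheaf.stalk x,
        (Ideal.span (Set.range s)).radical.IsMaximal → RingTheory.Sequence.IsWeaklyRegular (X₁.presheaf.stalk x) (List.ofFn s))) →
      ∀ η : X₁, (¬ IsClosed ({η} : Set X₁) ∧ ¬ (∀ d : ℕ, ringKrullDim (X₁.presheaf.stalk η) = d → ∀ s : Fin d → X₁.presheaf.stalk η,
          (Ideal.span (Set.range s)).radical.IsMaximal → ∀ t : X₁.presheaf.stalk η, (∃ e : ℕ, t ^ p ^ e ∈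
            Ideal.span ((fun z : X₁.presheaf.stalk η => z ^ p ^ e) '' (Ideal.span (Set.range s) : Set (X₁.presheaf.stalk η)))) →
              t ∈ Ideal.span (Set.range s)) ∧
        ∀ y : X₁, y ⤳ η → y ≠ η → (∀ d : ℕ, ringKrullDim (X₁.presheaf.stalk y) = d → ∀ s : Fin d → X₁.presheaf.stalk y,
          (Ideal.span (Set.range s)).radical.IsMaximal → ∀ t : X₁.presheaf.stalk y, (∃ e : ℕ, t ^ p ^ e ∈
            Ideal.span ((fun z : X₁.presheaf.stalk y => z ^ p ^ e) '' (Ideal.span (Set.range s) : Set (X₁.presheaf.stalk y)))) →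
              t ∈ Ideal.span (Set.range s))) →
      -- local dimension ≤ 3 at η (R16.19/R16.21: ONE mechanism for all local dimensions ≤ 3; ≥ 4 is the d ≥ 5 residual `FCUnguardedLocDimGe4`)
      ringKrullDim (X₁.presheaf.stalk η) ≤ 3 →
      ∃ (J : X₁.IdealSheafData) (n' : ℕ) (c' : Fin n' → X₁.presheaf.stalk η), J ≠ ⊥ ∧ η ∈ (J.support : Set X₁) ∧
      -- the RE-CHOSEN LocFix datum c' at η (currency (A′)): nonzero, inside 𝔪_η, charts FULL over 𝔪_η
      Ideal.span (Set.range c') ≠ ⊥ ∧ Ideal.span (Set.range c') ≤ maximalIdeal (X₁.presheaf.stalk η) ∧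
        (∀ (j : Fin n') (𝔔 : PrimeSpectrum (blowupAlgebra (Ideal.span (Set.range c')) (c' j))),
          𝔔.asIdeal.comap (algebraMap (X₁.presheaf.stalk η) (blowupAlgebra (Ideal.span (Set.range c')) (c' j))) =
            maximalIdeal (X₁.presheaf.stalk η) →
          IsDomain (Localization.AtPrime 𝔔.asIdeal) ∧ ∀ d : ℕ, ringKrullDim (Localization.AtPrime 𝔔.asIdeal) = d →
            ∀ s : Fin d → Localization.AtPrime 𝔔.asIdeal, (Ideal.span (Set.range s)).radical.IsMaximal →
              RingTheory.Sequence.IsWeaklyRegular (Localization.AtPrime 𝔔.asIdeal) (List.ofFn s) ∧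
              ∀ y : Localization.AtPrime 𝔔.asIdeal, (∃ e : ℕ, y ^ p ^ e ∈ Ideal.span ((fun z : Localization.AtPrime 𝔔.asIdeal => z ^ p ^ e) ''
                (Ideal.span (Set.range s) : Set (Localization.AtPrime 𝔔.asIdeal)))) → y ∈ Ideal.span (Set.range s)) ∧
      stalkIdeal J η = Ideal.span (Set.range c') ∧
      (∀ (X₂ : Scheme.{0}) (π : X₂ ⟶ X₁), IsBlowup π J →
        (∀ x : X₂, π.base x ∈ (J.support : Set X₁) → π.base x ≠ η → ¬ IsClosed ({x} : Set X₂) →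
          IsDomain (X₂.presheaf.stalk x) ∧ ∀ d : ℕ, ringKrullDim (X₂.presheaf.stalk x) = d → ∀ s : Fin d → X₂.presheaf.stalk x,
            (Ideal.span (Set.range s)).radical.IsMaximal → RingTheory.Sequence.IsWeaklyRegular (X₂.presheaf.stalk x) (List.ofFn s) ∧
            ∀ t : X₂.presheaf.stalk x, (∃ e : ℕ, t ^ p ^ e ∈ Ideal.span ((fun z : X₂.presheaf.stalk x => z ^ p ^ e) ''
              (Ideal.span (Set.range s) : Set (X₂.presheaf.stalk x)))) → t ∈ Ideal.span (Set.range s)) ∧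
        (∀ x : X₂, π.base x ∈ (J.support : Set X₁) → IsClosed ({x} : Set X₂) →
          ∀ d : ℕ, ringKrullDim (X₂.presheaf.stalk x) = d → ∀ s : Fin d → X₂.presheaf.stalk x,
            (Ideal.span (Set.range s)).radical.IsMaximal → RingTheory.Sequence.IsWeaklyRegular (X₂.presheaf.stalk x) (List.ofFn s)))


/-! ## §1 `locFixData_pow`: the (A′) datum in LocFix currency survives powers -/

section Chart

variable {R : Type} [CommRing R] {I : Ideal R} {g b : R} {k : ℕ}

/-- The transition `R[I/g] → R[I·Iᵏ/(g b)]` is compatible with the structure maps from `R`. [folklore] -/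
theorem blowupAlgebraMul_comp_algebraMap (hb : b ∈ I ^ k) :
    (blowupAlgebraMul I (I ^ k) g b hb).comp (algebraMap R (blowupAlgebra I g)) = algebraMap R (blowupAlgebra (I * I ^ k) (g * b)) := by
  ext r
  rw [RingHom.comp_apply, coe_blowupAlgebraMul, Subalgebra.coe_algebraMap, Subalgebra.coe_algebraMap, awayMul_algebraMap]

/-- `FullCl` at ONE prime descends along a localisation: `B''_{𝔔''} ≅ B_{𝔔'' ∩ B}`. [folklore] -/
theorem fullCl_atPrime_of_isLocalization_away_of_comap (p : ℕ) {B B'' : Type} [CommRing B] [CommRing B''] [Algebra B B''] (u : B)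
    [IsLocalization.Away u B''] (𝔔'' : PrimeSpectrum B'')
    (h : FullCl p (Localization.AtPrime (𝔔''.asIdeal.comap (algebraMap B B'')))) : FullCl p (Localization.AtPrime 𝔔''.asIdeal) := by
  haveI : IsLocalization.AtPrime (Localization.AtPrime 𝔔''.asIdeal) (𝔔''.asIdeal.comap (algebraMap B B'')) :=
    IsLocalization.isLocalization_isLocalization_atPrime_isLocalization (Submonoid.powers u)
      (Localization.AtPrime 𝔔''.asIdeal) 𝔔''.asIdeal
  exact WFixAtNonClosedDimTwo.fullCl_of_ringEquiv p
    (IsLocalization.algEquiv (𝔔''.asIdeal.comap (algebraMap B B'')).primeCompl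
      (Localization.AtPrime (𝔔''.asIdeal.comap (algebraMap B B''))) (Localization.AtPrime 𝔔''.asIdeal)).toRingEquiv h

/-- **FULL-over-`P` charts survive the passage to monomial charts**: if every local ring of `R[I/g]` at a prime OVER `P ⊆ R` is FULL, so is
every local ring of `R[I·Iᵏ/(g b)]` (`b ∈ Iᵏ`) at a prime over `P` — the contraction along `R[I/g] → R[I·Iᵏ/(g b)]` of a prime over `P` lies
over `P` (`blowupAlgebraMul_comp_algebraMap`). [folklore] -/
theorem fullCl_charts_mul_over (p : ℕ) (hg : g ∈ I) (hb : b ∈ I ^ k) (P : Ideal R)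
    (h : ∀ 𝔔 : PrimeSpectrum (blowupAlgebra I g), 𝔔.asIdeal.comap (algebraMap R (blowupAlgebra I g)) = P →
      FullCl p (Localization.AtPrime 𝔔.asIdeal))
    (𝔔'' : PrimeSpectrum (blowupAlgebra (I * I ^ k) (g * b)))
    (h𝔔'' : 𝔔''.asIdeal.comap (algebraMap R (blowupAlgebra (I * I ^ k) (g * b))) = P) :
    FullCl p (Localization.AtPrime 𝔔''.asIdeal) := by
  letI : Algebra (blowupAlgebra I g) (blowupAlgebra (I * I ^ k) (g * b)) := (blowupAlgebraMul I (I ^ k) g b hb).toAlgebra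
  haveI : IsLocalization.Away (blowupAlgebra.divPow I g hb) (blowupAlgebra (I * I ^ k) (g * b)) :=
    FCUnguardedAprimePow.isLocalization_away_mul_chart hg hb
  refine fullCl_atPrime_of_isLocalization_away_of_comap p (blowupAlgebra.divPow I g hb) 𝔔'' (h ⟨_, Ideal.comap_isPrime _ _⟩ ?_)
  change (𝔔''.asIdeal.comap (blowupAlgebraMul I (I ^ k) g b hb)).comap (algebraMap R (blowupAlgebra I g)) = P
  rw [Ideal.comap_comap, blowupAlgebraMul_comp_algebraMap hb, h𝔔'']

/-- Index transport for the chart clause over `P` (the chart type depends on the ideal and the element). [plumbing] -/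
theorem fullCl_charts_over_congr (p : ℕ) {J J' : Ideal R} {m m' : R} (hJ : J = J') (hm : m = m') (P : Ideal R)
    (h : ∀ 𝔔 : PrimeSpectrum (blowupAlgebra J m), 𝔔.asIdeal.comap (algebraMap R (blowupAlgebra J m)) = P →
      FullCl p (Localization.AtPrime 𝔔.asIdeal)) :
    ∀ 𝔔 : PrimeSpectrum (blowupAlgebra J' m'), 𝔔.asIdeal.comap (algebraMap R (blowupAlgebra J' m')) = P →
      FullCl p (Localization.AtPrime 𝔔.asIdeal) := by
  subst hJ hm
  exact h

/-- **FULL-over-`P` charts pass to the monomial charts of the power.** [folklore] -/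
theorem fullCl_charts_monomials_over (p : ℕ) {n' : ℕ} (c' : Fin n' → R) (k : ℕ) (P : Ideal R)
    (h : ∀ (j : Fin n') (𝔔 : PrimeSpectrum (blowupAlgebra (Ideal.span (Set.range c')) (c' j))),
      𝔔.asIdeal.comap (algebraMap R (blowupAlgebra (Ideal.span (Set.range c')) (c' j))) = P →
        FullCl p (Localization.AtPrime 𝔔.asIdeal))
    (t : Fin (n' ^ (k + 1)))
    (𝔔 : PrimeSpectrum (blowupAlgebra (Ideal.span (Set.range (fun t : Fin (n' ^ (k + 1)) => ∏ i, c' (finFunctionFinEquiv.symm t i))))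
      (∏ i, c' (finFunctionFinEquiv.symm t i))))
    (h𝔔 : 𝔔.asIdeal.comap (algebraMap R _) = P) : FullCl p (Localization.AtPrime 𝔔.asIdeal) := by
  obtain ⟨b, hb, ht⟩ := FCUnguardedAprimePow.monomials_eq_mul c' k t
  have hJ : Ideal.span (Set.range c') * Ideal.span (Set.range c') ^ k =
      Ideal.span (Set.range (fun t : Fin (n' ^ (k + 1)) => ∏ i, c' (finFunctionFinEquiv.symm t i))) := by
    rw [FCUnguardedAprimePow.span_monomials, pow_succ']
  exact fullCl_charts_over_congr p hJ ht.symm P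
    (fullCl_charts_mul_over p (I := Ideal.span (Set.range c')) (g := c' (finFunctionFinEquiv.symm t 0))
      (Ideal.subset_span ⟨finFunctionFinEquiv.symm t 0, rfl⟩) hb P (h (finFunctionFinEquiv.symm t 0))) 𝔔 h𝔔

end Chart

/-- [OURS · L1 W4.5a · res-L1-w45a-plan-1 R16.21 (2)] **The (A′) datum in LocFix currency survives powers**: if `(c′)` is a LocFix datum
at `η` (`(c′) ≠ ⊥`, `(c′) ≤ 𝔪_η`, every local ring of every chart `𝒪_η[(c′)/c′_j]` at a prime OVER `𝔪_η` FULL) and `𝒪_{X₁,η}` is reduced,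
then the degree-`(k+1)` monomials in `c′` form a LocFix datum generating `(c′)ᵏ⁺¹`. Same mechanism as
`FCUnguardedAprimePow.locFixDataFull_pow`, plus the remark that a prime over `𝔪_η` of a monomial chart contracts to a prime over `𝔪_η` of a
degree-one chart. Reducedness is needed only for `(c′)ᵏ⁺¹ ≠ ⊥`. [folklore; cite: StacksProject, Tag 080A] -/
theorem locFixData_pow {p : ℕ} {X₁ : Scheme.{0}} {η : X₁} [IsReduced (X₁.presheaf.stalk η)] {n' : ℕ}
    {c' : Fin n' → X₁.presheaf.stalk η} (h : FCUnguardedAprime.LocFixData p X₁ η n' c') (k : ℕ) :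
    FCUnguardedAprime.LocFixData p X₁ η (n' ^ (k + 1)) (fun t : Fin (n' ^ (k + 1)) => ∏ i, c' (finFunctionFinEquiv.symm t i)) ∧
      Ideal.span (Set.range (fun t : Fin (n' ^ (k + 1)) => ∏ i, c' (finFunctionFinEquiv.symm t i))) =
        Ideal.span (Set.range c') ^ (k + 1) := by
  obtain ⟨hne, hle, hcharts⟩ := h
  refine ⟨⟨?_, ?_, fun t 𝔔 h𝔔 => fullCl_charts_monomials_over p c' k _ hcharts t 𝔔 h𝔔⟩, FCUnguardedAprimePow.span_monomials c' k⟩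
  · -- `(c′)ᵏ⁺¹ ≠ ⊥` in the reduced ring `𝒪_η`
    rw [FCUnguardedAprimePow.span_monomials]
    obtain ⟨x, hx, hx0⟩ := (Submodule.ne_bot_iff _).mp hne
    intro hbot
    have hxk : x ^ (k + 1) ∈ Ideal.span (Set.range c') ^ (k + 1) := Ideal.pow_mem_pow hx (k + 1)
    rw [hbot, Ideal.mem_bot] at hxk
    exact hx0 (IsReduced.eq_zero x ⟨k + 1, hxk⟩)
  · rw [FCUnguardedAprimePow.span_monomials, pow_succ']
    exact Ideal.mul_le_right.trans hle

/-! ## §2 (T2′-LF) from the printed theorems BY NAME (res-L1-w45a-stub-2's kernel, p567448) -/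

/-- **(T2′-LF) HOLDS modulo Datta–Murayama 2024 Thm. B and openness of the Cohen–Macaulay locus** — res-L1-w45a-stub-2's
`SpreadLocFix.exists_spread_goodOver_of_DM_CMLocusOpen` in the binder shape of `SpreadGoodAprimeLF` (the hypotheses `IsSeparated f₁`,
`4 ≤ dim X₁`, «all stalks CM» are idle). [OURS · conditional-result; cite: DattaMurayama2024, Thm. B] -/
theorem spreadGoodAprimeLF_of_named
    (hDM : Literature.AlgebraicGeometry.Resolution.DattaMurayama2024_fInjectiveLocusOpen.{0})
    (hCMo : NonFullLocusClosed.CMLocusOpen) : SpreadGoodAprimeLF := by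
  intro p hp k _ _ X₁ f₁ _ hft hqc hi _ _ η n' c' hdat
  haveI := hft
  haveI := hqc
  haveI := hi
  obtain ⟨hne, hle, hcharts⟩ := hdat
  obtain ⟨J, U, hJ0, hηJ, hJη, hηU, hgood⟩ :=
    SpreadLocFix.exists_spread_goodOver_of_DM_CMLocusOpen hDM hCMo p hp k X₁ f₁ η n' c' hne hle hcharts
  exact ⟨J, U, hJ0, hηJ, hJη, hηU, fun X₂ π hπ => hgood X₂ π hπ⟩

/-! ## §3 The pow-assembly in LocFix currency, all local dimensions ≤ 3 -/

/-- The local-dimension case split below `3` in `WithBot ℕ∞`: `d ≤ 0`, or `d = 1`, or `2 ≤ d ≤ 3`. [plumbing] -/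
theorem locDim_cases_le3 (d : WithBot ℕ∞) (h : d ≤ 3) : d ≤ 0 ∨ d = 1 ∨ (2 ≤ d ∧ d ≤ 3) := by
  induction d using WithBot.recBotCoe with
  | bot => exact Or.inl bot_le
  | coe a =>
    induction a using ENat.recTopCoe with
    | top =>
      exfalso
      rw [← WithBot.coe_ofNat, WithBot.coe_le_coe] at h
      exact absurd h (by decide)
    | coe n =>
      have hn : n ≤ 3 := by
        rw [← WithBot.coe_ofNat, WithBot.coe_le_coe] at h
        exact_mod_cast h
      rcases Nat.lt_or_ge n 1 with h0 | h1
      · refine Or.inl ?_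
        rw [← WithBot.coe_zero, WithBot.coe_le_coe]
        exact_mod_cast (show n ≤ 0 by omega)
      · rcases Nat.lt_or_ge n 2 with h1' | h2
        · refine Or.inr (Or.inl ?_)
          have : n = 1 := by omega
          subst this
          rfl
        · refine Or.inr (Or.inr ⟨?_, h⟩)
          rw [← WithBot.coe_ofNat, WithBot.coe_le_coe]
          exact_mod_cast h2

/-- **A zero-dimensional stalk of an integral scheme over a field of characteristic `p` is F-good** (it is a field, hence a regular local
ring; `RegularPointClause.fiClause_stalk_of_isRegularLocalRing`). Used to discard the vacuous case `dim 𝒪_η ≤ 0` of a bad point. [folklore] -/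
theorem fCl_of_ringKrullDim_le_zero {p : ℕ} (hp : p.Prime) {k : Type} [Field k] [CharP k p] {X₁ : Scheme.{0}} [IsIntegral X₁]
    (f₁ : X₁ ⟶ Spec (.of k)) (η : X₁) (h0 : ringKrullDim (X₁.presheaf.stalk η) ≤ 0) : FCl p (X₁.presheaf.stalk η) := by
  haveI : Fact p.Prime := ⟨hp⟩
  haveI : Ring.KrullDimLE 0 (X₁.presheaf.stalk η) := Ring.krullDimLE_iff.mpr (by exact_mod_cast h0)
  have hF : IsField (X₁.presheaf.stalk η) := Ring.KrullDimLE.isField_of_isDomain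
  have hreg : IsRegularLocalRing (X₁.presheaf.stalk η) := by
    letI := hF.toField
    infer_instance
  obtain ⟨-, h⟩ := RegularPointClause.fiClause_stalk_of_isRegularLocalRing p f₁ η hreg
  exact fun d hd s hmax => (h d hd s hmax).2

/-- [OURS · L1 W4.5a · assembly, PROVED — res-L1-w45a-plan-1 R16.19 (3) / R16.21 (2)] **FC″(≥4) at a non-closed bad `η` with `dim 𝒪_η ≤ 3`
from (T1‴) + (T1′) + (T2′-LF) + (T3′-pow).** `dim 𝒪_η ≤ 0` cannot occur (`fCl_of_ringKrullDim_le_zero` against the bad-point hypothesis);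
for `dim 𝒪_η = 1` take the datum of (T1‴), for `2 ≤ dim 𝒪_η ≤ 3` that of (T1′) — an (A′) datum `(c′)` in LocFix currency either way; spread
it (T2′-LF) to `J₀` with `stalkIdeal J₀ η = (c′)`, good over `supp J₀ ∩ U`, `η ∈ U`; `Z := supp J₀ ∖ U` (closed, `∌ η`); (T3′-pow) gives `J`
good over all of `supp J` with `stalkIdeal J x = (stalkIdeal J₀ x)ᵐ⁺¹` off `Z`, so `stalkIdeal J η = (c′)ᵐ⁺¹` = the span of the
degree-`(m+1)` monomials in `c′`, a LocFix datum again (`locFixData_pow`; `𝒪_η` is a domain since `X₁` is integral); hence `J ≠ ⊥`,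
`η ∈ supp J`, and FC″'s (A′), (nc), (cl) clauses verbatim. [folklore assembly, OURS; no named fact] -/
theorem fcUnguardedLocDimLe3_of_aprime_pow (h₀ : LocFixAtNonClosedDimOne) (h₁ : FCUnguardedAprime.LocFixAtNonClosed)
    (h₂ : SpreadGoodAprimeLF) (h₃ : FCUnguardedAprime.RelClosedSubsetFixPow) : FCUnguardedLocDimLe3 := by
  intro p hp k _ _ X₁ f₁ hs hft hqc hi h4 hCM η hη h3
  obtain ⟨hηcl, hbad, hgen⟩ := hη
  haveI := hi
  -- the (A′) datum at `η`, by cases on `dim 𝒪_η`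
  obtain ⟨n', c', hdat⟩ : ∃ (n' : ℕ) (c' : Fin n' → X₁.presheaf.stalk η), FCUnguardedAprime.LocFixData p X₁ η n' c' := by
    rcases locDim_cases_le3 _ h3 with hd0 | hd1 | ⟨hd2, hd3⟩
    · exact absurd (fCl_of_ringKrullDim_le_zero hp f₁ η hd0) hbad
    · exact h₀ p hp k X₁ f₁ hs hft hqc hi h4 hCM η hηcl hbad hd1 hgen
    · exact h₁ p hp k X₁ f₁ hs hft hqc hi h4 hCM η hηcl hbad hd2 hd3 hgen
  obtain ⟨J₀, U, -, -, hstalk, hηU, hgood⟩ := h₂ p hp k X₁ f₁ hs hft hqc hi h4 hCM η n' c' hdat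
  -- `Z := supp J₀ ∖ U`
  have hZcl : IsClosed ((J₀.support : Set X₁) \ (U : Set X₁)) := J₀.support.isClosed.sdiff U.isOpen
  have hZsub : (J₀.support : Set X₁) \ (U : Set X₁) ⊆ (J₀.support : Set X₁) := fun x hx => hx.1
  have hZeq : (J₀.support : Set X₁) \ ((J₀.support : Set X₁) \ (U : Set X₁)) = (J₀.support : Set X₁) ∩ (U : Set X₁) := by
    ext x
    constructor
    · rintro ⟨hx, hx'⟩
      exact ⟨hx, by_contra fun hxU => hx' ⟨hx, hxU⟩⟩
    · rintro ⟨hx, hxU⟩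
      exact ⟨hx, fun h => h.2 hxU⟩
  have hgoodZ : FCUnguardedAprime.GoodOver p X₁ J₀ ((J₀.support : Set X₁) \ ((J₀.support : Set X₁) \ (U : Set X₁))) := by
    rw [hZeq]
    exact hgood
  obtain ⟨J, n, hn, hJeq, hJgood⟩ := h₃ p hp k X₁ f₁ hs hft hqc hi h4 hCM J₀ _ hZcl hZsub hgoodZ
  obtain ⟨m, rfl⟩ := Nat.exists_eq_succ_of_ne_zero hn.ne'
  -- the degree-`(m+1)` monomials in `c′`: a LocFix datum generating `(c′)^{m+1} = stalkIdeal J η`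
  obtain ⟨⟨hne, hle, hcharts⟩, hspan⟩ := locFixData_pow hdat m
  have hηZ : η ∉ (J₀.support : Set X₁) \ (U : Set X₁) := fun h => h.2 hηU
  have hJη : stalkIdeal J η = Ideal.span (Set.range (fun t : Fin (n' ^ (m + 1)) => ∏ i, c' (finFunctionFinEquiv.symm t i))) := by
    rw [hJeq η hηZ, hstalk, hspan]
  refine ⟨J, n' ^ (m + 1), fun t => ∏ i, c' (finFunctionFinEquiv.symm t i), ?_, ?_, hne, hle, fun j 𝔔 h𝔔 => hcharts j 𝔔 h𝔔, hJη,
    fun X₂ π hπ => ?_⟩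
  · -- `J ≠ ⊥` since `J_η = (c′)^{m+1} ≠ ⊥`
    intro hJ
    apply hne
    rw [← hJη, hJ]
    exact stalkIdeal_bot η
  · -- `η ∈ supp J` since `J_η ≤ 𝔪_η`
    exact (mem_support_iff_stalkIdeal_le J η).mpr (by rw [hJη]; exact hle)
  · obtain ⟨hnc, hcl⟩ := hJgood X₂ π hπ
    exact ⟨fun x hx _ hxcl => hnc x hx hxcl, fun x hx hxcl => hcl x hx hxcl⟩

/-! ## §4 The splitter and the corollary for door v31 -/

/-- **SPLITTER**: `FC″(dim ≥ 4) ⇐ FCUnguardedLocDimLe3 + (loc. dim ≥ 4 residual)` — dichotomy `dim 𝒪_η ≤ 3 ∨ 4 ≤ dim 𝒪_η` in `WithBot ℕ∞`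
(`FCUnguardedAprime.locDim_trichotomy`). [plumbing] -/
theorem fcUnguardedDimGe4_of_le3_ge4 (h₃ : FCUnguardedLocDimLe3) (h₄ : FCUnguardedAprime.FCUnguardedLocDimGe4) :
    FCUnguardedRungs.FCUnguardedDimGe4 := by
  intro p hp k _ _ X₁ f₁ hs hft hqc hi h4 hCM η hη
  rcases FCUnguardedAprime.locDim_trichotomy (ringKrullDim (X₁.presheaf.stalk η)) with hd | ⟨-, hd3⟩ | hd
  · exact h₃ p hp k X₁ f₁ hs hft hqc hi h4 hCM η hη (hd.trans (by exact_mod_cast (show (1 : ℕ) ≤ 3 by omega)))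
  · exact h₃ p hp k X₁ f₁ hs hft hqc hi h4 hCM η hη hd3
  · exact h₄ p hp k X₁ f₁ hs hft hqc hi h4 hCM η hη hd

/-- [OURS · L1 W4.5a · THEOREM modulo named facts and the two research residuals] **FC″(≥4) at local dimension ≤ 3 from (T1‴) and (T3′-pow)
ALONE, modulo Lipman 1978, Cossart–Piltant 2019 (general / principalization) + Stacks 081R, Datta–Murayama 2024 Thm. B and openness of the
CM locus**: (T1′) := `FCUnguardedAprime.locFixAtNonClosed_of_facts` (p564701/p566975), (T2′-LF) := `spreadGoodAprimeLF_of_named` (stub-2,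
p567448). The term res-L1-w45a-lead-1's door v31 consumes for the DERIVED `stub_fcUnguarded`. [folklore assembly, OURS; cite: Lipman1978;
CossartPiltant2019, Thm. 1.1; DattaMurayama2024, Thm. B] -/
theorem fcUnguardedLocDimLe3_of_facts
    (hL : Literature.AlgebraicGeometry.Resolution.Lipman1978SequenceFinite.{0})
    (hG : Literature.AlgebraicGeometry.Resolution.CossartPiltant2019General.{0})
    (h081R : Literature.AlgebraicGeometry.Resolution.Stacks081R.{0})
    (hP : Literature.AlgebraicGeometry.Resolution.CossartPiltant2019Principalization.{0})
    (hDM : Literature.AlgebraicGeometry.Resolution.DattaMurayama2024_fInjectiveLocusOpen.{0})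
    (hCMo : NonFullLocusClosed.CMLocusOpen) (h₀ : LocFixAtNonClosedDimOne) (h₃ : FCUnguardedAprime.RelClosedSubsetFixPow) :
    FCUnguardedLocDimLe3 :=
  fcUnguardedLocDimLe3_of_aprime_pow h₀ (FCUnguardedAprime.locFixAtNonClosed_of_facts hL hG h081R hP hDM hCMo)
    (spreadGoodAprimeLF_of_named hDM hCMo) h₃

end Summit.ResolutionOfSingularities.ResolutionOfSingularities.Theorems.FInjectiveMacaulayfication.FCUnguardedLocDimLe3

end
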